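import Literature.Probability.RandomPlanarGeometry.CurveSpace
import Mathlib.MeasureTheory.Constructions.Polish.Basic
import HarnessLib

/-!
# Decoder measurability: a Borel left inverse of the tournament-bit map (Lusin–Souslin)

Helper file for the registered stubs `stub_quadTransfer_decoderInverse` and
`stub_quadTransfer_measurableBits` of line `hitting-tournament` of crux `LagHandOff`
(stmt-CriticalPhenomena-10268).  They are the abstract content of step (e) (decoding) of the
method behind `stub_quadTransfer` (R1): once the tournament bits `n ↦ 𝟙[γ ∈ Bₙ]` of a curve
class `γ` (countably many Borel class events `Bₙ`: order bits, location bits) separate the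
classes of a Borel set `R ⊆ CurveClass ℂ` of full measure, the decoder `Ψ := Φ ∘ bits` is a Borel
map, where `Φ` is a Borel left inverse of the bit map on `R`.

* `exists_measurable_leftInverse_of_injOn` — **a Borel map of curve classes into `ℕ → Bool`,
  injective on a Borel set `R`, has a Borel left inverse on `R`** (Lusin–Souslin: `CurveClass ℂ`
  is Polish, so `R` is standard Borel and an injective Borel map on it is a measurable embedding,
  `Measurable.measurableEmbedding`; extend the inverse by a constant,
  `MeasurableEmbedding.exists_measurable_extend`).
* `measurable_bits` — the `ℕ`-indexed bit map `γ ↦ (n ↦ 𝟙[γ ∈ Bₙ])` is Borel when every `Bₙ` is.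
* `stub_quadTransfer_decoderInverse`, `stub_quadTransfer_measurableBits` — the registered
  one-line forms.

References: A. S. Kechris, *Classical Descriptive Set Theory*, Springer GTM 156 (1995), Thm. 15.1
(Lusin–Souslin) and Cor. 15.2 (a Borel injection has Borel image and Borel inverse); in Mathlib:
`Mathlib/MeasureTheory/Constructions/Polish/Basic.lean`.
-/

noncomputable section

open MeasureTheory Set Topology
open Literature.Probability.RandomPlanarGeometry

namespace Summit.CriticalPhenomena.CardyFormulaZ2.Cruxes.LagHandOff.HittingTournament

/-- **A Borel map injective on a Borel set of curve classes has a Borel left inverse there**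
(Lusin–Souslin: `CurveClass ℂ` is Polish, `ℕ → Bool` is countably separated).  Outside the image
of `R` the inverse is an arbitrary constant class. -/
theorem exists_measurable_leftInverse_of_injOn {R : Set (CurveClass ℂ)} (hR : MeasurableSet R)
    {b : CurveClass ℂ → (ℕ → Bool)} (hb : Measurable b) (hinj : Set.InjOn b R) :
    ∃ Φ : (ℕ → Bool) → CurveClass ℂ, Measurable Φ ∧ ∀ γ ∈ R, Φ (b γ) = γ := by
  haveI : StandardBorelSpace R := hR.standardBorel
  have hmeas : Measurable (R.restrict b) := hb.comp measurable_subtype_coe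
  have hinj' : Function.Injective (R.restrict b) := Set.injOn_iff_injective.1 hinj
  have hemb : MeasurableEmbedding (R.restrict b) := hmeas.measurableEmbedding hinj'
  obtain ⟨Φ, hΦm, hΦ⟩ := hemb.exists_measurable_extend measurable_subtype_coe
    (fun _ => ⟨CurveClass.mk (Curve.const (0 : ℂ))⟩)
  refine ⟨Φ, hΦm, fun γ hγ => ?_⟩
  have := congrFun hΦ ⟨γ, hγ⟩
  simpa using this

open scoped Classical in
/-- **The tournament-bit map is Borel**: for Borel class events `B n`, `n : ℕ` (an enumeration
of the countably many order bits and location bits), the map `γ ↦ (n ↦ 𝟙[γ ∈ B n])` into the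
Cantor space `ℕ → Bool` is measurable. -/
theorem measurable_bits (B : ℕ → Set (CurveClass ℂ)) (hB : ∀ n, MeasurableSet (B n)) :
    Measurable (fun γ : CurveClass ℂ => fun n => decide (γ ∈ B n)) := by
  refine measurable_pi_lambda _ fun n => ?_
  apply measurable_to_bool
  have : (fun γ : CurveClass ℂ => decide (γ ∈ B n)) ⁻¹' {true} = B n := by
    ext γ; simp
  rw [this]
  exact hB n

/-! ### Registered forms -/

/-- **Registered stub `stub_quadTransfer_decoderInverse`** (line `hitting-tournament`, R1
method step (e)): `exists_measurable_leftInverse_of_injOn`, one-line form. -/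
theorem stub_quadTransfer_decoderInverse : ∀ {R : Set (CurveClass ℂ)}, MeasurableSet R → ∀ {b : CurveClass ℂ → (ℕ → Bool)}, Measurable b → Set.InjOn b R → ∃ Φ : (ℕ → Bool) → CurveClass ℂ, Measurable Φ ∧ ∀ γ ∈ R, Φ (b γ) = γ :=
  @exists_measurable_leftInverse_of_injOn

/-- **Registered stub `stub_quadTransfer_measurableBits`** (line `hitting-tournament`, R1
method step (e)): `measurable_bits`, one-line form with the classical decidability instance
spelled out. -/
theorem stub_quadTransfer_measurableBits : ∀ (B : ℕ → Set (CurveClass ℂ)), (∀ n, MeasurableSet (B n)) → Measurable (fun γ : CurveClass ℂ => fun n => @decide (γ ∈ B n) (Classical.propDecidable (γ ∈ B n))) :=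
  measurable_bits

end Summit.CriticalPhenomena.CardyFormulaZ2.Cruxes.LagHandOff.HittingTournament

end
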